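import Summits.CriticalPhenomena.PercolationContinuityZ3.Theorems.SahiTP2CIS

/-!
# On the whole plane: TP₂ across cuts ⟺ conditionally increasing almost everywhere; comonotone laws

Companion of `SahiTP2Kernel.lean` / `SahiTP2CIS.lean` (cell `prim-sahi`, typer seat, generation 10;
`--supports stmt-CriticalPhenomena-4575`).  Mathlib only.

`SahiTP2Kernel.exists_cisKernel` produces an EVERYWHERE stochastically increasing version of the conditional law of a
cut-TP₂ law carried by a horizontal strip.  Without the strip such a version need not exist (the law of `(X, 1/(1-X))`,
`X` uniform on `(0,1)`, is cut-TP₂, but `κ_1` would have to dominate every `δ_{1/(1-x)}`).  What survives is the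
almost-everywhere statement, which is all that `IsTP2Cut` can see:

* `exists_aeCisKernel` — every finite cut-TP₂ measure `ρ` on `ℝ × ℝ` is `ρ.fst ⊗ₘ κ` for a Markov kernel `κ`
  (Mathlib's conditional cdf kernel) that is stochastically increasing on a set of full `ρ.fst`-measure;
* `IsTP2Cut.compProd_of_anti_ae` — conversely such laws are cut-TP₂;
* `isTP2Cut_iff_exists_aeCisKernel` — **on `ℝ²`, TP₂ across cuts ⟺ conditionally increasing (a.e.)**.
* `IsTP2Cut.map_monotone_pair` — comonotone laws (the law of `(g₁(U), g₂(U))` for monotone `g₁, g₂` and ANY law of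
  `U` on a linear order) are cut-TP₂: one of the two products on the left always vanishes.

No sorries, no new axioms.
-/

noncomputable section

namespace Summit.CriticalPhenomena.PercolationContinuityZ3.Theorems.SahiTP2

open MeasureTheory ProbabilityTheory Set Filter Topology Metric Function
open scoped ENNReal

/-! ## Comonotone laws -/

/-- **Comonotone laws are TP₂ across cuts**: for monotone `g₁ : γ → α`, `g₂ : γ → β` on a linear order `γ` and any
measure `ν` on `γ`, the joint law of `(g₁, g₂)` under `ν` satisfies `IsTP2Cut` (indeed `ν(g₁ ∈ I₁, g₂ ∉ L) · ν(g₁ ∈ I₂,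
g₂ ∈ L) = 0`). [this work] -/
theorem IsTP2Cut.map_monotone_pair {α β γ : Type*} [Preorder α] [TopologicalSpace α] [OrderClosedTopology α]
    [MeasurableSpace α] [OpensMeasurableSpace α] [Preorder β] [MeasurableSpace β] [LinearOrder γ] [MeasurableSpace γ]
    (ν : Measure γ) {g₁ : γ → α} {g₂ : γ → β} (hg₁ : Monotone g₁) (hg₂ : Monotone g₂)
    (hm : Measurable fun u => (g₁ u, g₂ u)) : IsTP2Cut (ν.map fun u => (g₁ u, g₂ u)) := by
  intro a₁ b₁ a₂ b₂ hlt L hL hLm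
  rw [Measure.map_apply hm (measurableSet_Icc.prod hLm.compl), Measure.map_apply hm (measurableSet_Icc.prod hLm)]
  -- one of the two preimages is empty
  by_cases hA : ((fun u => (g₁ u, g₂ u)) ⁻¹' (Icc a₁ b₁ ×ˢ Lᶜ)).Nonempty
  · obtain ⟨u, hu⟩ := hA
    have hB : (fun u => (g₁ u, g₂ u)) ⁻¹' (Icc a₂ b₂ ×ˢ L) = ∅ := by
      refine eq_empty_of_forall_notMem fun u' hu' => ?_
      simp only [mem_preimage, mem_prod, mem_Icc, mem_compl_iff] at hu hu'
      have huu' : u < u' := by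
        by_contra h
        exact lt_irrefl _ (lt_of_le_of_lt ((hu'.1.1.trans (hg₁ (not_lt.1 h))).trans hu.1.2) hlt)
      exact hu.2 (hL (hg₂ huu'.le) hu'.2)
    rw [hB, measure_empty, mul_zero]
    exact bot_le
  · rw [not_nonempty_iff_eq_empty.1 hA, measure_empty, zero_mul]
    exact bot_le

/-! ## The plane: a version of the conditional law that is monotone almost everywhere -/

variable (ρ : Measure (ℝ × ℝ))

/-- The strip-free good set: Besicovitch limits to `preCDF`, Stieltjes point, `preCDF ≤ 1`, balls of positive mass.
[this work] -/
def goodSet₀ : Set ℝ :=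
  {a | (∀ q : ℚ, Tendsto (fun h : ℝ => ρ.IicSnd q (closedBall a h) / ρ.fst (closedBall a h)) (𝓝[>] 0)
      (𝓝 (preCDF ρ q a))) ∧
    IsRatStieltjesPoint (fun a q => (preCDF ρ q a).toReal) a ∧ (∀ q : ℚ, preCDF ρ q a ≤ 1) ∧
    (∀ h : ℝ, 0 < h → 0 < ρ.fst (closedBall a h))}

variable {ρ}

/-- The strip-free good set has full measure. [this work] -/
theorem ae_mem_goodSet₀ [IsFiniteMeasure ρ] : ∀ᵐ a ∂ρ.fst, a ∈ goodSet₀ ρ := by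
  have h1 : ∀ᵐ a ∂ρ.fst, ∀ q : ℚ, Tendsto (fun h : ℝ => ρ.IicSnd q (closedBall a h) / ρ.fst (closedBall a h))
      (𝓝[>] 0) (𝓝 (preCDF ρ q a)) := by
    rw [ae_all_iff]
    intro q
    haveI : IsFiniteMeasure (ρ.IicSnd q) := Measure.IsFiniteMeasure.IicSnd (ρ := ρ) q
    exact Besicovitch.ae_tendsto_rnDeriv (ρ.IicSnd q) ρ.fst
  have h2 : ∀ᵐ a ∂ρ.fst, IsRatStieltjesPoint (fun a q => (preCDF ρ q a).toReal) a := by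
    have h := (isRatCondKernelCDF_preCDF ρ).isRatStieltjesPoint_ae ()
    simp only [Kernel.const_apply] at h
    filter_upwards [h] with a ha using (isRatStieltjesPoint_unit_prod_iff _ a).1 ha
  filter_upwards [h1, h2, preCDF_le_one ρ, ae_fst_closedBall_pos ρ] with a ha1 ha2 ha3 ha4
  exact ⟨ha1, ha2, ha3, ha4⟩

/-- `preCDF` is antitone on the strip-free good set of a cut-TP₂ law. [this work] -/
theorem preCDF_anti_of_mem_goodSet₀ [IsFiniteMeasure ρ] (hρ : IsTP2Cut ρ) {a b : ℝ} (ha : a ∈ goodSet₀ ρ)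
    (hb : b ∈ goodSet₀ ρ) (hab : a ≤ b) (q : ℚ) : preCDF ρ q b ≤ preCDF ρ q a := by
  rcases hab.eq_or_lt with rfl | hlt
  · exact le_rfl
  refine le_of_tendsto_of_tendsto (hb.1 q) (ha.1 q) ?_
  have hpos : (0 : ℝ) < (b - a) / 2 := by linarith
  filter_upwards [Ioo_mem_nhdsGT hpos] with h hh
  have hh' : a + h < b - h := by linarith [hh.2]
  exact ratio_le_ratio ρ hρ hh' q (ha.2.2.2 h hh.1)

/-- **Mathlib's conditional cdf is antitone in the conditioning variable on the good set** of a cut-TP₂ law.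
[this work] -/
theorem condCDF_anti_of_mem_goodSet₀ [IsFiniteMeasure ρ] (hρ : IsTP2Cut ρ) {a b : ℝ} (ha : a ∈ goodSet₀ ρ)
    (hb : b ∈ goodSet₀ ρ) (hab : a ≤ b) (x : ℝ) : condCDF ρ b x ≤ condCDF ρ a x := by
  have hval : ∀ c ∈ goodSet₀ ρ, ∀ r : ℚ, condCDF ρ c r = (preCDF ρ r c).toReal := fun c hc r => by
    rw [condCDF, stieltjesOfMeasurableRat_eq, toRatCDF_of_isRatStieltjesPoint hc.2.1]
  rw [← StieltjesFunction.iInf_rat_gt_eq (condCDF ρ b) x, ← StieltjesFunction.iInf_rat_gt_eq (condCDF ρ a) x]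
  have hbdd : BddBelow (range fun r : {r' : ℚ // x < r'} => condCDF ρ b r) :=
    ⟨0, by rintro y ⟨r, rfl⟩; exact condCDF_nonneg ρ b _⟩
  refine ciInf_mono hbdd fun r => ?_
  rw [hval b hb, hval a ha]
  exact ENNReal.toReal_mono ((ha.2.2.1 r).trans_lt ENNReal.one_lt_top).ne (preCDF_anti_of_mem_goodSet₀ hρ ha hb hab r)

/-- **A.e.-monotone version, no strip.** Every finite cut-TP₂ measure on `ℝ × ℝ` is the composition-product of its first
marginal with a Markov kernel (the conditional-cdf kernel) which is stochastically increasing on a set of full measure.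
[this work] -/
theorem exists_aeCisKernel [IsFiniteMeasure ρ] (hρ : IsTP2Cut ρ) :
    ∃ κ : Kernel ℝ ℝ, IsMarkovKernel κ ∧ ρ.fst ⊗ₘ κ = ρ ∧ ∃ G : Set ℝ, (∀ᵐ a ∂ρ.fst, a ∈ G) ∧
      ∀ ⦃a b : ℝ⦄, a ∈ G → b ∈ G → a ≤ b → ∀ t : ℝ, κ b (Iic t) ≤ κ a (Iic t) := by
  have hK := isCondKernelCDF_condCDF ρ
  set K := hK.toKernel _ with hKdef
  refine ⟨Kernel.comap K (fun a => ((), a)) measurable_prodMk_left, inferInstance, ?_, goodSet₀ ρ, ae_mem_goodSet₀,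
    fun a b ha hb hab t => ?_⟩
  · have h2 : Kernel.prodMkLeft Unit (Kernel.comap K (fun a => ((), a)) measurable_prodMk_left) = K := by
      ext p s hs
      rcases p with ⟨u, a⟩
      rfl
    have h3 : Kernel.const Unit ρ.fst ⊗ₖ K = Kernel.const Unit ρ := compProd_toKernel hK
    rw [Measure.compProd, h2, h3, Kernel.const_apply]
  · rw [Kernel.comap_apply, Kernel.comap_apply, hKdef, IsCondKernelCDF.toKernel_Iic, IsCondKernelCDF.toKernel_Iic]
    exact ENNReal.ofReal_le_ofReal (condCDF_anti_of_mem_goodSet₀ hρ ha hb hab t)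

/-- **Conversely**: a composition-product `μ₁ ⊗ₘ κ` with `κ` stochastically increasing on measurable lower sets ALMOST
everywhere (on a set of full `μ₁`-measure) is TP₂ across cuts. [this work] -/
theorem IsTP2Cut.compProd_of_anti_ae {α β : Type*} [Preorder α] [TopologicalSpace α] [OrderClosedTopology α]
    [MeasurableSpace α] [OpensMeasurableSpace α] [Preorder β] [MeasurableSpace β] (μ₁ : Measure α) [SFinite μ₁]
    (κ : Kernel α β) [IsMarkovKernel κ] {G : Set α} (hG : ∀ᵐ a ∂μ₁, a ∈ G)
    (hκ : ∀ ⦃a b : α⦄, a ∈ G → b ∈ G → a ≤ b → ∀ ⦃L : Set β⦄, IsLowerSet L → MeasurableSet L → κ b L ≤ κ a L) :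
    IsTP2Cut (μ₁ ⊗ₘ κ) := by
  intro a₁ b₁ a₂ b₂ hlt L hL hLm
  have hmL : Measurable fun a => κ a L := κ.measurable_coe hLm
  have hmLc : Measurable fun a => κ a Lᶜ := κ.measurable_coe hLm.compl
  rw [Measure.compProd_apply_prod measurableSet_Icc hLm.compl, Measure.compProd_apply_prod measurableSet_Icc hLm,
    Measure.compProd_apply_prod measurableSet_Icc hLm, Measure.compProd_apply_prod measurableSet_Icc hLm.compl,
    ← lintegral_lintegral_mul hmLc.aemeasurable hmL.aemeasurable,
    ← lintegral_lintegral_mul hmL.aemeasurable hmLc.aemeasurable]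
  refine setLIntegral_mono_ae' measurableSet_Icc ?_
  filter_upwards [hG] with x hxG hx
  refine setLIntegral_mono_ae' measurableSet_Icc ?_
  filter_upwards [hG] with x' hx'G hx'
  have hxx' : x ≤ x' := hx.2.trans (hlt.le.trans hx'.1)
  have hvu : κ x' L ≤ κ x L := hκ hxG hx'G hxx' hL hLm
  rw [prob_compl_eq_one_sub hLm, prob_compl_eq_one_sub hLm]
  calc (1 - κ x L) * κ x' L ≤ (1 - κ x' L) * κ x L := mul_le_mul' (tsub_le_tsub_left hvu 1) hvu
    _ = κ x L * (1 - κ x' L) := mul_comm _ _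

/-- **On the plane, TP₂ across cuts ⟺ conditionally increasing (almost everywhere).** [this work] -/
theorem isTP2Cut_iff_exists_aeCisKernel (ρ : Measure (ℝ × ℝ)) [IsFiniteMeasure ρ] :
    IsTP2Cut ρ ↔ ∃ κ : Kernel ℝ ℝ, IsMarkovKernel κ ∧ ρ.fst ⊗ₘ κ = ρ ∧ ∃ G : Set ℝ, (∀ᵐ a ∂ρ.fst, a ∈ G) ∧
      ∀ ⦃a b : ℝ⦄, a ∈ G → b ∈ G → a ≤ b → ∀ t : ℝ, κ b (Iic t) ≤ κ a (Iic t) := by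
  refine ⟨fun hρ => exists_aeCisKernel hρ, ?_⟩
  rintro ⟨κ, hκM, hdis, G, hG, hκ⟩
  rw [← hdis]
  exact IsTP2Cut.compProd_of_anti_ae ρ.fst κ hG fun a b ha hb hab L hL _ =>
    measure_lowerSet_le_of_Iic (κ b) (κ a) (hκ ha hb hab) hL

end Summit.CriticalPhenomena.PercolationContinuityZ3.Theorems.SahiTP2
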